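import Summits.HodgeConjecture.HodgeCM.PerL34.FockPrintGenuineCompact_1

/-! PORT of `HodgeCM/PerL34/FockPrintGenuineCompact.lean` (HodgeCMPerL run 82) — part 2: continuation of `Summits.HodgeConjecture.HodgeCM.PerL34.FockPrintGenuineCompact_1` (split at a top-level declaration boundary by port_pkg.py; scope re-opened below; declarations unchanged). -/

-- port_pkg: scope re-opened for this part (file-level context, then the namespace/section stack open at the cut)
set_option autoImplicit false
open MvPolynomial Complex
open scoped Matrix ComplexConjugate Kronecker
namespace HodgeCM.PerL34.Fock.PrintDict
section Plane
/-- (Ported verbatim from the HodgeCMPerL package; no docstring in the source.) -/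
theorem kvMat_mul (g h : Matrix (Fin 2) (Fin 2) ℂ) : kvMat (g * h) = kvMat g * kvMat h := by
  unfold kvMat
  rw [Matrix.fromBlocks_multiply, mapStar_mul, ← one_mul (1 : Matrix (Fin 2) (Fin 2) ℂ),
    Matrix.mul_kronecker_mul, one_mul]
  simp

/-- (Ported verbatim from the HodgeCMPerL package; no docstring in the source.) -/
theorem kvMat_one : kvMat 1 = 1 := by
  unfold kvMat
  rw [mapStar_one, Matrix.one_kronecker_one, Matrix.fromBlocks_one]

/-- (Ported verbatim from the HodgeCMPerL package; no docstring in the source.) -/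
theorem kwMat_mem (g : Matrix.unitaryGroup (Fin 2) ℂ) : kwMat (g : Matrix (Fin 2) (Fin 2) ℂ) ∈ Matrix.unitaryGroup PlaneVar ℂ :=
  fromBlocks_diag_mem_unitaryGroup
    (Matrix.kronecker_mem_unitary (SetLike.coe_mem (1 : Matrix.unitaryGroup (Fin 2) ℂ))
      (Matrix.map_star_mem_unitaryGroup_iff.mpr g.2))
    g.2

/-- (Ported verbatim from the HodgeCMPerL package; no docstring in the source.) -/
theorem kvMat_mem (h : Matrix.unitaryGroup (Fin 2) ℂ) : kvMat (h : Matrix (Fin 2) (Fin 2) ℂ) ∈ Matrix.unitaryGroup PlaneVar ℂ :=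
  fromBlocks_diag_mem_unitaryGroup
    (Matrix.kronecker_mem_unitary (Matrix.map_star_mem_unitaryGroup_iff.mpr h.2)
      (SetLike.coe_mem (1 : Matrix.unitaryGroup (Fin 2) ℂ)))
    (SetLike.coe_mem (1 : Matrix.unitaryGroup (Fin 2) ℂ))

/-- **The genuine embedding `KW : U(2)_W ↪ U(6)`** (a group homomorphism into honest unitary `6 × 6` matrices, to be
fed to Folland's `ν₀ = Hermite.fockRep`). -/
noncomputable def KW : Matrix.unitaryGroup (Fin 2) ℂ →* Matrix.unitaryGroup PlaneVar ℂ where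
  toFun g := ⟨kwMat g, kwMat_mem g⟩
  map_one' := Subtype.ext (by
    change kwMat ((1 : Matrix.unitaryGroup (Fin 2) ℂ) : Matrix (Fin 2) (Fin 2) ℂ) = ((1 : Matrix.unitaryGroup PlaneVar ℂ) : Matrix _ _ ℂ)
    rw [OneMemClass.coe_one, OneMemClass.coe_one]; exact kwMat_one)
  map_mul' g h := Subtype.ext (by
    change kwMat ((g * h : Matrix.unitaryGroup (Fin 2) ℂ) : Matrix (Fin 2) (Fin 2) ℂ) = kwMat g * kwMat h
    rw [Submonoid.coe_mul]; exact kwMat_mul _ _)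

/-- **The genuine embedding `KV : U(2)_V = U(V⁺) ↪ U(6)`.** -/
noncomputable def KV : Matrix.unitaryGroup (Fin 2) ℂ →* Matrix.unitaryGroup PlaneVar ℂ where
  toFun h := ⟨kvMat h, kvMat_mem h⟩
  map_one' := Subtype.ext (by
    change kvMat ((1 : Matrix.unitaryGroup (Fin 2) ℂ) : Matrix (Fin 2) (Fin 2) ℂ) = ((1 : Matrix.unitaryGroup PlaneVar ℂ) : Matrix _ _ ℂ)
    rw [OneMemClass.coe_one, OneMemClass.coe_one]; exact kvMat_one)
  map_mul' g h := Subtype.ext (by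
    change kvMat ((g * h : Matrix.unitaryGroup (Fin 2) ℂ) : Matrix (Fin 2) (Fin 2) ℂ) = kvMat g * kvMat h
    rw [Submonoid.coe_mul]; exact kvMat_mul _ _)

/-- **The genuine embedding `KL : U(1)_V = U(V⁻) ↪ U(6)`**: `u ↦ 1 ⊕ u·1` = the tree's torus with exponents `−wWt`
(`ν₀(KL u) F = F(z, u⁻¹w)`: `U(V⁻)` acts on the `w`-letters DUALLY, `dGamma_genV_wline`). -/
noncomputable def KL : Circle →* Matrix.unitaryGroup PlaneVar ℂ := torusHom (-wWt)

/-- (Ported verbatim from the HodgeCMPerL package; no docstring in the source.) -/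
@[simp] theorem coe_KW (g : Matrix.unitaryGroup (Fin 2) ℂ) : (KW g : Matrix PlaneVar PlaneVar ℂ) = kwMat g := rfl
/-- (Ported verbatim from the HodgeCMPerL package; no docstring in the source.) -/
@[simp] theorem coe_KV (h : Matrix.unitaryGroup (Fin 2) ℂ) : (KV h : Matrix PlaneVar PlaneVar ℂ) = kvMat h := rfl

/-- (Ported verbatim from the HodgeCMPerL package; no docstring in the source.) -/
theorem kwMat_ll (g : Matrix (Fin 2) (Fin 2) ℂ) (a a' x y : Fin 2) :
    kwMat g (Sum.inl (a, x)) (Sum.inl (a', y)) = (1 : Matrix (Fin 2) (Fin 2) ℂ) a a' * star (g x y) := rfl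
/-- (Ported verbatim from the HodgeCMPerL package; no docstring in the source.) -/
theorem kwMat_rr (g : Matrix (Fin 2) (Fin 2) ℂ) (x y : Fin 2) : kwMat g (Sum.inr x) (Sum.inr y) = g x y := rfl
/-- (Ported verbatim from the HodgeCMPerL package; no docstring in the source.) -/
theorem kwMat_lr (g : Matrix (Fin 2) (Fin 2) ℂ) (v : Fin 2 × Fin 2) (y : Fin 2) : kwMat g (Sum.inl v) (Sum.inr y) = 0 := rfl
/-- (Ported verbatim from the HodgeCMPerL package; no docstring in the source.) -/
theorem kwMat_rl (g : Matrix (Fin 2) (Fin 2) ℂ) (x : Fin 2) (v : Fin 2 × Fin 2) : kwMat g (Sum.inr x) (Sum.inl v) = 0 := rfl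

/-- (Ported verbatim from the HodgeCMPerL package; no docstring in the source.) -/
theorem kvMat_ll (h : Matrix (Fin 2) (Fin 2) ℂ) (a b x y : Fin 2) :
    kvMat h (Sum.inl (a, x)) (Sum.inl (b, y)) = star (h a b) * (1 : Matrix (Fin 2) (Fin 2) ℂ) x y := rfl
/-- (Ported verbatim from the HodgeCMPerL package; no docstring in the source.) -/
theorem kvMat_rr (h : Matrix (Fin 2) (Fin 2) ℂ) (x y : Fin 2) :
    kvMat h (Sum.inr x) (Sum.inr y) = (1 : Matrix (Fin 2) (Fin 2) ℂ) x y := rfl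
/-- (Ported verbatim from the HodgeCMPerL package; no docstring in the source.) -/
theorem kvMat_lr (h : Matrix (Fin 2) (Fin 2) ℂ) (v : Fin 2 × Fin 2) (y : Fin 2) : kvMat h (Sum.inl v) (Sum.inr y) = 0 := rfl
/-- (Ported verbatim from the HodgeCMPerL package; no docstring in the source.) -/
theorem kvMat_rl (h : Matrix (Fin 2) (Fin 2) ℂ) (x : Fin 2) (v : Fin 2 × Fin 2) : kvMat h (Sum.inr x) (Sum.inl v) = 0 := rfl

/-- **Consistency with RUN 29's genuine torus**: on the diagonal torus of `U(2)_W`, `KW` IS `planeTorusHom`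
(`FockPrintGenuineTorus`): `KW (diag(u₀,u₁)) = torusU (colWt 0) u₀ · torusU (colWt 1) u₁`. -/
theorem KW_phaseU (u : Fin 2 → Circle) : KW (phaseU u) = planeTorusHom (u 0, u 1) := by
  apply Subtype.ext
  rw [coe_KW, planeTorusHom_apply, Submonoid.coe_mul, torusU, torusU, coe_phaseU, coe_phaseU, coe_phaseU,
    Matrix.diagonal_mul_diagonal]
  ext p q
  rcases p with ⟨a, x⟩ | x <;> rcases q with ⟨a', y⟩ | y
  · rw [kwMat_ll, Matrix.diagonal_apply, Matrix.one_apply, Matrix.diagonal_apply]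
    by_cases h : a = a'
    · subst h
      by_cases hxy : x = y
      · subst hxy
        rw [if_pos rfl, if_pos rfl, one_mul, Complex.star_def, ← Circle.coe_inv_eq_conj]
        fin_cases x <;> simp [colWt]
      · rw [if_neg hxy, if_neg (fun h => hxy (Prod.ext_iff.mp (Sum.inl_injective h)).2), star_zero, mul_zero]
    · rw [if_neg h, zero_mul, if_neg (fun h' => h (Prod.ext_iff.mp (Sum.inl_injective h')).1)]
  · rw [kwMat_lr, Matrix.diagonal_apply_ne _ Sum.inl_ne_inr]
  · rw [kwMat_rl, Matrix.diagonal_apply_ne _ Sum.inr_ne_inl]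
  · rw [kwMat_rr, Matrix.diagonal_apply, Matrix.diagonal_apply]
    by_cases hxy : x = y
    · subst hxy
      rw [if_pos rfl, if_pos rfl]
      fin_cases x <;> simp [colWt]
    · rw [if_neg hxy, if_neg (fun h => hxy (Sum.inr_injective h))]

/-- The matrix of `KL u` is `1 ⊕ u·1`. -/
theorem coe_KL (u : Circle) :
    (KL u : Matrix PlaneVar PlaneVar ℂ) = Matrix.fromBlocks (1 : Matrix (Fin 2 × Fin 2) (Fin 2 × Fin 2) ℂ) 0 0 ((u : ℂ) • 1) := by
  change (torusU (-wWt) u : Matrix PlaneVar PlaneVar ℂ) = _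
  rw [torusU, coe_phaseU]
  ext p q
  rcases p with v | x <;> rcases q with v' | y
  · rw [Matrix.fromBlocks_apply₁₁, Matrix.diagonal_apply, Matrix.one_apply]
    by_cases h : v = v'
    · subst h; simp [wWt]
    · rw [if_neg (fun h' => h (Sum.inl_injective h')), if_neg h]
  · rw [Matrix.fromBlocks_apply₁₂, Matrix.diagonal_apply_ne _ Sum.inl_ne_inr, Matrix.zero_apply]
  · rw [Matrix.fromBlocks_apply₂₁, Matrix.diagonal_apply_ne _ Sum.inr_ne_inl, Matrix.zero_apply]
  · rw [Matrix.fromBlocks_apply₂₂, Matrix.diagonal_apply, Matrix.smul_apply, Matrix.one_apply, smul_eq_mul, mul_ite,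
      mul_one, mul_zero]
    by_cases h : x = y
    · subst h; simp [wWt]
    · rw [if_neg (fun h' => h (Sum.inr_injective h')), if_neg h]

/-- The three genuine compact embeddings pairwise commute inside `U(6)` (block structure). -/
theorem KV_mul_KW (h g : Matrix.unitaryGroup (Fin 2) ℂ) : KV h * KW g = KW g * KV h := by
  apply Subtype.ext
  rw [Submonoid.coe_mul, Submonoid.coe_mul, coe_KW, coe_KV]
  unfold kwMat kvMat
  rw [Matrix.fromBlocks_multiply, Matrix.fromBlocks_multiply, ← Matrix.mul_kronecker_mul, ← Matrix.mul_kronecker_mul]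
  simp

/-! ## §5  Infinitesimally: `d/dt ν₀(KW(g_t)) = dΓ(genW ġ)` and `d/dt ν₀(KV(h_t)) = dΓ(genV ḣ)` IN `L²(ℂ⁶)`,
and the printed operators as honest derivatives (consuming pv05-g7's `Hermite.hasDerivAt_fockRep_path_one`) -/

/-- The velocity of `t ↦ kwMat (g t)` when `g` has velocity `β`: `(1 ⊗ β̄) ⊕ β`. -/
noncomputable def kwVel (β : Matrix (Fin 2) (Fin 2) ℂ) : Matrix PlaneVar PlaneVar ℂ :=
  Matrix.fromBlocks ((1 : Matrix (Fin 2) (Fin 2) ℂ) ⊗ₖ β.map star) 0 0 β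

/-- The velocity of `t ↦ kvMat (h t)` when `h` has velocity `β`: `(β̄ ⊗ 1) ⊕ 0`. -/
noncomputable def kvVel (β : Matrix (Fin 2) (Fin 2) ℂ) : Matrix PlaneVar PlaneVar ℂ :=
  Matrix.fromBlocks (β.map star ⊗ₖ (1 : Matrix (Fin 2) (Fin 2) ℂ)) 0 0 0

/-- For SKEW-HERMITIAN `β` (every velocity at `1` of a unitary path is, `Hermite.star_eq_neg_of_hasDerivAt_unitaryGroup`)
the velocity `kwVel β` is the Lie-algebra embedding `genW β` of §2. -/
theorem kwVel_eq_genW {β : Matrix (Fin 2) (Fin 2) ℂ} (hβ : star β = -β) : kwVel β = genW β := by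
  have hβ' : ∀ x y, star (β x y) = -β y x := fun x y => by
    have := congr_fun (congr_fun hβ y) x
    rwa [Matrix.star_apply, Matrix.neg_apply] at this
  ext p q
  rcases p with ⟨a, x⟩ | x <;> rcases q with ⟨a', y⟩ | y
  · change (1 : Matrix (Fin 2) (Fin 2) ℂ) a a' * star (β x y) = _
    rw [genW_ll, hβ', Matrix.one_apply]
    split_ifs <;> simp
  · rfl
  · rfl
  · rfl

/-- (Ported verbatim from the HodgeCMPerL package; no docstring in the source.) -/
theorem kvVel_eq_genV {β : Matrix (Fin 2) (Fin 2) ℂ} (hβ : star β = -β) :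
    kvVel β = genV (Matrix.fromBlocks β 0 0 (0 : Matrix Unit Unit ℂ)) := by
  have hβ' : ∀ x y, star (β x y) = -β y x := fun x y => by
    have := congr_fun (congr_fun hβ y) x
    rwa [Matrix.star_apply, Matrix.neg_apply] at this
  ext p q
  rcases p with ⟨a, x⟩ | x <;> rcases q with ⟨b, y⟩ | y
  · change star (β a b) * (1 : Matrix (Fin 2) (Fin 2) ℂ) x y = _
    rw [genV_ll, hβ', Matrix.one_apply, Matrix.fromBlocks_apply₁₁]
    split_ifs <;> simp
  · rfl
  · rfl
  · change (0 : ℂ) = _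
    rw [genV_rr, Matrix.fromBlocks_apply₂₂, Matrix.zero_apply, ite_self]

/-- The `V⁺`-block lift `β ↦ β ⊕ 0 ∈ 𝔤𝔩(V)` is compact. -/
theorem isCompactV_fromBlocks (β : Matrix (Fin 2) (Fin 2) ℂ) :
    IsCompactV (Matrix.fromBlocks β 0 0 (0 : Matrix Unit Unit ℂ)) :=
  ⟨fun a => Matrix.fromBlocks_apply₁₂ _ _ _ _ a (), fun a => Matrix.fromBlocks_apply₂₁ _ _ _ _ () a⟩

section Deriv

variable {g : ℝ → Matrix.unitaryGroup (Fin 2) ℂ} {β : Matrix (Fin 2) (Fin 2) ℂ} {t₀ : ℝ}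

/-- Entrywise differentiability of `t ↦ KW (g t)` from that of `g`. -/
theorem hasDerivAt_coe_KW (hg : ∀ x y, HasDerivAt (fun t => (g t : Matrix (Fin 2) (Fin 2) ℂ) x y) (β x y) t₀) :
    ∀ p q, HasDerivAt (fun t => (KW (g t) : Matrix PlaneVar PlaneVar ℂ) p q) (kwVel β p q) t₀ := by
  rintro (⟨a, x⟩ | x) (⟨a', y⟩ | y)
  · exact ((hg x y).star).const_mul ((1 : Matrix (Fin 2) (Fin 2) ℂ) a a')
  · exact hasDerivAt_const t₀ (0 : ℂ)
  · exact hasDerivAt_const t₀ (0 : ℂ)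
  · exact hg x y

/-- Entrywise differentiability of `t ↦ KV (g t)` from that of `g`. -/
theorem hasDerivAt_coe_KV (hg : ∀ x y, HasDerivAt (fun t => (g t : Matrix (Fin 2) (Fin 2) ℂ) x y) (β x y) t₀) :
    ∀ p q, HasDerivAt (fun t => (KV (g t) : Matrix PlaneVar PlaneVar ℂ) p q) (kvVel β p q) t₀ := by
  rintro (⟨a, x⟩ | x) (⟨b, y⟩ | y)
  · exact ((hg a b).star).mul_const ((1 : Matrix (Fin 2) (Fin 2) ℂ) x y)
  · exact hasDerivAt_const t₀ (0 : ℂ)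
  · exact hasDerivAt_const t₀ (0 : ℂ)
  · exact hasDerivAt_const t₀ ((1 : Matrix (Fin 2) (Fin 2) ℂ) x y)

/-- **`dΓ(genW ġ)` generates `ν₀ ∘ KW` (KERNEL, in `L²(ℂ⁶)`).**  If `g : ℝ → U(2)_W` is entrywise differentiable at
`t₀` with velocity `β` and `g t₀ = 1`, then for every polynomial `F` the honest vector-valued map
`t ↦ ν₀(KW(g t))(F·e^{−(π/2)|z|²}) ∈ 𝓕 ⊂ L²(ℂ⁶)` has derivative `(dΓ(genW β) F)·e^{−(π/2)|z|²}` at `t₀`. -/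
theorem hasDerivAt_fockRep_KW (hg : ∀ x y, HasDerivAt (fun t => (g t : Matrix (Fin 2) (Fin 2) ℂ) x y) (β x y) t₀)
    (h1 : g t₀ = 1) (F : PlaneModel) :
    HasDerivAt (fun t => Hermite.fockRep (KW (g t)) (Hermite.fockToL2 F))
      (Hermite.fockToL2 (Hermite.dGamma (genW β) F)) t₀ := by
  have h := Hermite.hasDerivAt_fockRep_path_one (γ := fun t => KW (g t)) (hasDerivAt_coe_KW hg)
    (by simp only [h1, map_one]) F
  rwa [kwVel_eq_genW (Hermite.star_eq_neg_of_hasDerivAt_unitaryGroup hg h1)] at h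

/-- **… and it is Adams's PRINTED `ρ(1 ⊗ β)` minus the cover character `½ tr β` (KERNEL).** -/
theorem hasDerivAt_fockRep_KW_printed
    (hg : ∀ x y, HasDerivAt (fun t => (g t : Matrix (Fin 2) (Fin 2) ℂ) x y) (β x y) t₀) (h1 : g t₀ = 1)
    (lam : ℂ) (F : PlaneModel) :
    HasDerivAt (fun t => Hermite.fockRep (KW (g t)) (Hermite.fockToL2 F))
      (Hermite.fockToL2 (fockOp (sf planeWt) (ee planeWt) (ff planeWt) lam (rho planeWt (plW β)) F
        - ((1 / 2 : ℂ) * β.trace) • F)) t₀ := by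
  have h := hasDerivAt_fockRep_KW hg h1 F
  rwa [show Hermite.dGamma (genW β) F = fockOp (sf planeWt) (ee planeWt) (ff planeWt) lam (rho planeWt (plW β)) F
      - ((1 / 2 : ℂ) * β.trace) • F by
    rw [fockOp_rho_plW_eq_dGamma, LinearMap.add_apply, LinearMap.smul_apply, Module.End.one_apply, add_sub_cancel_right]]
    at h

/-- **`dΓ(genV ḣ)` generates `ν₀ ∘ KV` (KERNEL, in `L²(ℂ⁶)`).** -/
theorem hasDerivAt_fockRep_KV (hg : ∀ x y, HasDerivAt (fun t => (g t : Matrix (Fin 2) (Fin 2) ℂ) x y) (β x y) t₀)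
    (h1 : g t₀ = 1) (F : PlaneModel) :
    HasDerivAt (fun t => Hermite.fockRep (KV (g t)) (Hermite.fockToL2 F))
      (Hermite.fockToL2 (Hermite.dGamma (genV (Matrix.fromBlocks β 0 0 (0 : Matrix Unit Unit ℂ))) F)) t₀ := by
  have h := Hermite.hasDerivAt_fockRep_path_one (γ := fun t => KV (g t)) (hasDerivAt_coe_KV hg)
    (by simp only [h1, map_one]) F
  rwa [kvVel_eq_genV (Hermite.star_eq_neg_of_hasDerivAt_unitaryGroup hg h1)] at h

/-- **… and it is Adams's PRINTED `ρ((β ⊕ 0) ⊗ 1)` minus the vacuum character `tr β = β₀₀ + β₁₁` (KERNEL).** -/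
theorem hasDerivAt_fockRep_KV_printed
    (hg : ∀ x y, HasDerivAt (fun t => (g t : Matrix (Fin 2) (Fin 2) ℂ) x y) (β x y) t₀) (h1 : g t₀ = 1)
    (lam : ℂ) (F : PlaneModel) :
    HasDerivAt (fun t => Hermite.fockRep (KV (g t)) (Hermite.fockToL2 F))
      (Hermite.fockToL2 (fockOp (sf planeWt) (ee planeWt) (ff planeWt) lam
          (rho planeWt (plV (Matrix.fromBlocks β 0 0 (0 : Matrix Unit Unit ℂ)))) F - β.trace • F)) t₀ := by
  have h := hasDerivAt_fockRep_KV hg h1 F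
  have key : Hermite.dGamma (genV (Matrix.fromBlocks β 0 0 (0 : Matrix Unit Unit ℂ))) F
      = fockOp (sf planeWt) (ee planeWt) (ff planeWt) lam
          (rho planeWt (plV (Matrix.fromBlocks β 0 0 (0 : Matrix Unit Unit ℂ)))) F - β.trace • F := by
    rw [fockOp_rho_plV_eq_dGamma_of_isCompactV lam (isCompactV_fromBlocks β), LinearMap.add_apply,
      LinearMap.smul_apply, Module.End.one_apply, Matrix.fromBlocks_apply₁₁, Matrix.fromBlocks_apply₁₁,
      Matrix.fromBlocks_apply₂₂, Matrix.zero_apply, sub_zero, Matrix.trace_fin_two, add_sub_cancel_right]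
  rwa [key] at h

/-- **`U(1)_V` genuinely (KERNEL)**: `d/dθ|₀ ν₀(KL(e^{iθ}))(F·e^{−…}) = −i·(weightOp wWt F)·e^{−…}` = `i·dΓ(genV E_ww) F`
— the honest derivative whose printed counterpart is `−i(weightOp wWt + 1)` (`fockOp_rho_plV_wline`). -/
theorem hasDerivAt_fockRep_KL (F : PlaneModel) :
    HasDerivAt (fun θ : ℝ => Hermite.fockRep (KL (Circle.exp θ)) (Hermite.fockToL2 F))
      (I • Hermite.fockToL2 (Hermite.dGamma (genV (Matrix.single (Sum.inr ()) (Sum.inr ()) 1)) F)) 0 := by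
  have h := hasDerivAt_fockRep_torusU_exp_zero (-wWt) F
  have hneg : weightOp (-wWt) F = -(weightOp wWt F) := by
    simp only [weightOp_apply, Pi.neg_apply, Int.cast_neg, neg_smul, Finset.sum_neg_distrib]
  rw [hneg] at h
  rw [dGamma_genV_wline, LinearMap.neg_apply]
  exact h

end Deriv

end Plane

end HodgeCM.PerL34.Fock.PrintDict
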